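import Literature.Computability.QuantumComplexity.ZXCalculusBending
import HarnessLib

/-!
# `ZX_{π/4}` modulo the calculus: scalars move freely; the Hopf law

Topic `Literature/Computability/QuantumComplexity`, continuing `ZXCalculusBending.lean` (layer A8 of
the formalisation of `JeandelPerdrixVilmart2018_completeness`): the first lemma of JPV's appendix
that is NOT an axiom, derived inside the term calculus.

* Scalars (closed diagrams `s : 0 → 0`) behave as expected: `scalar_par_eq_seq` (`s ⊗ t = s ⨾ t`,
  Eckmann–Hilton), `scalar_par_comm`, `scalar_seq_comm`, `scalar_par_wires` (`s ⊗ 𝕀 = 𝕀 ⊗ s`),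
  `scalar_par_seq_left/right` (a scalar attached to a composite may be attached to either factor),
  `empty_par_eq` (`𝕀⁰ ⊗ A` up to identity casts);
* JPV's scalar `√2 = X^{(0,1)}(0) ⨾ Z^{(1,0)}(0)` (`dumbbell 0 0`) equals its colour swap (= its
  flip) `Z^{(0,1)}(0) ⨾ X^{(1,0)}(0)` (`dumbbell_zero_symm`), by bending both through a cup;
* the "yanking with a twist" identity `(𝕀 ⊗ η) ⨾ (σ ⊗ 𝕀) ⨾ (𝕀 ⊗ ε) = 𝕀` (`yank_twist`);
* (B1), (B2) in the flipped / colour-swapped forms used below (`rule_B1_effect`, `rule_B2_red`), and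
  the two "copy disconnects" consequences with JPV's `√2` (`sqrt_two_par_X_split_par_effect`,
  `sqrt_two_par_state_par_X_merge`);
* **the Hopf law** (JPV Lemma 3): `√2 · √2 · (X^{(1,2)} ⨾ Z^{(2,1)}) = X^{(1,0)} ⨾ Z^{(0,1)}`
  (`hopf`), following Backens–Perdrix–Wang's derivation (bialgebra on the doubled wire seen through
  a cup and a cap, then copy), with JPV's exact scalars: (B2) consumes one `√2`, (B1) the other.

## References

* E. Jeandel, S. Perdrix, R. Vilmart, LICS 2018 (arXiv:1705.11151v2), Appendix Lemma 3 (Hopf law)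
  [JeandelPerdrixVilmart2018].
* M. Backens, S. Perdrix, Q. Wang, *A simplified stabilizer ZX-calculus*, QPL 2016
  (arXiv:1602.04744), App. A, Lemma "Hopf law" (the derivation followed here).
* B. Coecke, R. Duncan, New J. Phys. 13 (2011), §9 (Hopf law from bialgebra) [CoeckeDuncan2011].
-/

noncomputable section

namespace Literature.Computability.QuantumComplexity

open ZXDiagram ZXClass

variable {n m k : ℕ}

namespace ZXClass

/-! ### Scalars move freely -/

/-- Eckmann–Hilton: juxtaposing two scalars is composing them. [folklore] -/
theorem scalar_par_eq_seq (s t : ZXClass 0 0) : s ⊠ t = s ⨟ t := by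
  calc s ⊠ t = (s ⨟ mk (wires 0)) ⊠ (mk (wires 0) ⨟ t) := by rw [seq_id, id_seq]
    _ = (s ⊠ mk (wires 0)) ⨟ (mk (wires 0) ⊠ t) := by rw [interchange]
    _ = s ⨟ t := by rw [par_empty, empty_par, cast_id]

/-- Scalars commute under `⊗`. [folklore] -/
theorem scalar_par_comm (s t : ZXClass 0 0) : s ⊠ t = t ⊠ s := by
  rw [scalar_par_eq_seq]
  calc s ⨟ t = (mk (wires 0) ⊠ s) ⨟ (t ⊠ mk (wires 0)) := by rw [par_empty, empty_par, cast_id]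
    _ = (mk (wires 0) ⨟ t) ⊠ (s ⨟ mk (wires 0)) := by rw [interchange]
    _ = t ⊠ s := by rw [id_seq, seq_id]

/-- Scalars commute under `⨾`. [folklore] -/
theorem scalar_seq_comm (s t : ZXClass 0 0) : s ⨟ t = t ⨟ s := by
  rw [← scalar_par_eq_seq, scalar_par_comm, scalar_par_eq_seq]

/-- A scalar on the left of a wire equals the scalar on its right: `s ⊗ 𝕀 = 𝕀 ⊗ s` (naturality
of the crossing `χ₀ = 𝕀` at the closed diagram `s`). [folklore] -/
theorem scalar_par_wires (s : ZXClass 0 0) : s ⊠ mk (wires 1) = mk (wires 1) ⊠ s := by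
  have h := swap_nat s
  simpa using h

/-- A scalar attached to a composite is attached to its second factor. [folklore] -/
theorem scalar_par_seq_right (s : ZXClass 0 0) (A : ZXClass n m) (B : ZXClass m k) :
    s ⊠ (A ⨟ B) = (mk (wires 0) ⊠ A) ⨟ (s ⊠ B) := by
  rw [interchange, id_seq]

/-- A scalar attached to a composite is attached to its first factor. [folklore] -/
theorem scalar_par_seq_left (s : ZXClass 0 0) (A : ZXClass n m) (B : ZXClass m k) :
    s ⊠ (A ⨟ B) = (s ⊠ A) ⨟ (mk (wires 0) ⊠ B) := by
  rw [interchange, seq_id]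

/-- `𝕀⁰ ⊗ A` is `A` up to identity casts (which vanish at numeral arities). [folklore] -/
theorem empty_par_eq (A : ZXClass n m) :
    mk (wires 0) ⊠ A = ofEq (Nat.zero_add n) ⨟ A ⨟ ofEq (Nat.zero_add m).symm := by
  rw [empty_par, cast_eq_ofEq]

/-- Two scalars attached to a diagram may be exchanged. [folklore] -/
theorem scalar_par_scalar_par (s t : ZXClass 0 0) (A : ZXClass n m) :
    s ⊠ (t ⊠ A) = t ⊠ (s ⊠ A) := by
  rw [par_assoc', par_assoc', scalar_par_comm]

/-! ### `√2` is colourless -/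

/-- JPV's scalar `√2`, `X^{(0,1)}(0) ⨾ Z^{(1,0)}(0)`, drawn on a cup: `η ⨾ (Z^{(1,0)} ⊗ X^{(1,0)})`.
[cite: JeandelPerdrixVilmart2018, §2.2] -/
theorem dumbbell_zero_eq_cup : mk (dumbbell 0 0) = mk cup ⨟ (mk (Z 1 0 0) ⊠ mk (X 1 0 0)) := by
  rw [dumbbell, mk_seq, ← cup_seq_par_xeffect, seq_assoc]
  congr 1
  calc mk (wires 1) ⊠ mk (X 1 0 0) ⨟ mk (Z 1 0 0)
        = (mk (wires 1) ⊠ mk (X 1 0 0)) ⨟ (mk (Z 1 0 0) ⊠ mk (wires 0)) := by rw [par_empty]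
    _ = mk (Z 1 0 0) ⊠ mk (X 1 0 0) := by rw [interchange, id_seq, seq_id]

/-- The colour-swapped `√2`, `Z^{(0,1)}(0) ⨾ X^{(1,0)}(0)`, drawn on a cup. [cite: JeandelPerdrixVilmart2018, §2.2] -/
theorem dumbbell_zero_swap_eq_cup :
    mk (Z 0 1 0) ⨟ mk (X 1 0 0) = mk cup ⨟ (mk (X 1 0 0) ⊠ mk (Z 1 0 0)) := by
  rw [← cup_seq_par_effect, seq_assoc]
  congr 1
  calc mk (wires 1) ⊠ mk (Z 1 0 0) ⨟ mk (X 1 0 0)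
        = (mk (wires 1) ⊠ mk (Z 1 0 0)) ⨟ (mk (X 1 0 0) ⊠ mk (wires 0)) := by rw [par_empty]
    _ = mk (X 1 0 0) ⊠ mk (Z 1 0 0) := by rw [interchange, id_seq, seq_id]

/-- Two effects on a cup may be exchanged (symmetry of the cup and naturality of the crossing).
[folklore] -/
theorem cup_seq_par_comm (A B : ZXClass 1 0) : mk cup ⨟ (A ⊠ B) = mk cup ⨟ (B ⊠ A) := by
  have hA : A ⊠ mk (wires 1) = mk swap ⨟ (mk (wires 1) ⊠ A) := by
    have h := swap_nat A
    simpa using h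
  calc mk cup ⨟ (A ⊠ B) = mk cup ⨟ ((A ⊠ mk (wires 1)) ⨟ (mk (wires 0) ⊠ B)) := by
          rw [← par_eq_seq_left]
    _ = mk cup ⨟ mk swap ⨟ ((mk (wires 1) ⊠ A) ⨟ (mk (wires 0) ⊠ B)) := by
          rw [hA, seq_assoc, seq_assoc]
    _ = mk cup ⨟ (B ⊠ A) := by rw [cup_swap, empty_par, cast_id, par_eq_seq_right B A, par_empty]

/-- **`√2` is colourless**: `X^{(0,1)}(0) ⨾ Z^{(1,0)}(0) = Z^{(0,1)}(0) ⨾ X^{(1,0)}(0)`. [folklore] -/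
theorem dumbbell_zero_symm : mk (dumbbell 0 0) = mk (Z 0 1 0) ⨟ mk (X 1 0 0) := by
  rw [dumbbell_zero_eq_cup, dumbbell_zero_swap_eq_cup, cup_seq_par_comm]

/-- `√2` is its own colour swap. [folklore] -/
@[simp] theorem mk_colorSwap_dumbbell_zero : mk (dumbbell 0 0).colorSwap = mk (dumbbell 0 0) := by
  conv_rhs => rw [dumbbell_zero_symm]
  simp [dumbbell]

/-- `√2` is its own flip. [folklore] -/
@[simp] theorem mk_transpose_dumbbell_zero : mk (dumbbell 0 0).transpose = mk (dumbbell 0 0) := by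
  conv_rhs => rw [dumbbell_zero_symm]
  simp [dumbbell]

/-! ### Yanking with a twist -/

/-- **Yanking with a twist**: `(𝕀 ⊗ η) ⨾ (σ ⊗ 𝕀) ⨾ (𝕀 ⊗ ε) = 𝕀` (the cap is symmetric, the cup
slides under the crossings, snake). [cite: JeandelPerdrixVilmart2018, §2.2] -/
theorem yank_twist :
    (mk (wires 1) ⊠ mk cup) ⨟ (mk swap ⊠ mk (wires 1)) ⨟ (mk (wires 1) ⊠ mk cap) = mk (wires 1) := by
  conv_lhs => rw [← swap_cap, wires_par_seq, ← seq_assoc, seq_assoc (mk (wires 1) ⊠ mk cup),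
    ← fswap1_two, ← fswap1_nat, fswap1_zero, id_seq]
  exact snake_right

/-- Yanking with a twist next to a by-passing wire: `(𝕀² ⊗ η) ⨾ (𝕀 ⊗ σ ⊗ 𝕀) ⨾ (𝕀² ⊗ ε) = 𝕀²`.
[cite: JeandelPerdrixVilmart2018, §2.2] -/
theorem yank_twist_two : (mk (wires 2) ⊠ mk cup) ⨟ ((mk (wires 1) ⊠ mk swap) ⊠ mk (wires 1)) ⨟
    (mk (wires 2) ⊠ mk cap) = mk (wires 2) := by
  have h1 : mk (wires 2) ⊠ mk cup = mk (wires 1) ⊠ (mk (wires 1) ⊠ mk cup) := by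
    rw [← wires_par_wires 1 1]; exact (par_assoc _ _ _).trans (cast_id _ _ _)
  have h2 : (mk (wires 1) ⊠ mk swap) ⊠ mk (wires 1) = mk (wires 1) ⊠ (mk swap ⊠ mk (wires 1)) :=
    (par_assoc _ _ _).trans (cast_id _ _ _)
  have h3 : mk (wires 2) ⊠ mk cap = mk (wires 1) ⊠ (mk (wires 1) ⊠ mk cap) := by
    rw [← wires_par_wires 1 1]; exact (par_assoc _ _ _).trans (cast_id _ _ _)
  rw [h1, h2, h3, ← wires_par_seq, ← wires_par_seq, yank_twist, wires_par_wires]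

/-! ### (B1) and (B2) in the forms used by the Hopf law -/

/-- (B1) flipped and colour-swapped: a red merge followed by a green effect is two green effects,
`√2 · (X^{(2,1)} ⨾ Z^{(1,0)}) = Z^{(1,0)} ⊗ Z^{(1,0)}`. [cite: JeandelPerdrixVilmart2018, Fig. 1 (B1)] -/
theorem rule_B1_effect :
    mk (dumbbell 0 0) ⊠ (mk (X 2 1 0) ⨟ mk (Z 1 0 0)) = mk (Z 1 0 0) ⊠ mk (Z 1 0 0) := by
  have h := congrArg transpose (congrArg colorSwap rule_B1)
  simpa [dumbbell] using h

/-- (B2) colour-swapped: `√2 · ((X^{(1,2)} ⊗ X^{(1,2)}) ⨾ (𝕀 ⊗ σ ⊗ 𝕀) ⨾ (Z^{(2,1)} ⊗ Z^{(2,1)}))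
= Z^{(2,1)} ⨾ X^{(1,2)}`. [cite: JeandelPerdrixVilmart2018, Fig. 1 (B2)] -/
theorem rule_B2_red : mk (dumbbell 0 0) ⊠ ((mk (X 1 2 0) ⊠ mk (X 1 2 0)) ⨟
    ((mk (wires 1) ⊠ mk swap) ⊠ mk (wires 1)) ⨟ (mk (Z 2 1 0) ⊠ mk (Z 2 1 0))) =
      mk (Z 2 1 0) ⨟ mk (X 1 2 0) := by
  have h := congrArg colorSwap rule_B2
  simpa using h

/-! ### The Hopf law -/

/-- The doubled wire between a red split and a green merge, redrawn through a cup and a cap as a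
bialgebra pattern fed by `X^{(0,1)}(0)` and closed by `Z^{(1,0)}(0)`. [cite: JeandelPerdrixVilmart2018, Appendix Lemma 3] -/
theorem X_split_seq_Z_merge_eq : mk (X 1 2 0) ⨟ mk (Z 2 1 0) =
    (mk (wires 1) ⊠ mk (X 0 1 0)) ⨟ ((mk (X 1 2 0) ⊠ mk (X 1 2 0)) ⨟
      ((mk (wires 1) ⊠ mk swap) ⊠ mk (wires 1)) ⨟ (mk (Z 2 1 0) ⊠ mk (Z 2 1 0))) ⨟
        (mk (wires 1) ⊠ mk (Z 1 0 0)) := by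
  symm
  calc (mk (wires 1) ⊠ mk (X 0 1 0)) ⨟ ((mk (X 1 2 0) ⊠ mk (X 1 2 0)) ⨟
      ((mk (wires 1) ⊠ mk swap) ⊠ mk (wires 1)) ⨟ (mk (Z 2 1 0) ⊠ mk (Z 2 1 0))) ⨟
        (mk (wires 1) ⊠ mk (Z 1 0 0))
        = (mk (X 1 2 0) ⊠ mk cup) ⨟ ((mk (wires 1) ⊠ mk swap) ⊠ mk (wires 1)) ⨟
            (mk (Z 2 1 0) ⊠ mk cap) := by
          simp only [seq_assoc]
          rw [← seq_assoc (mk (wires 1) ⊠ mk (X 0 1 0)),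
            interchange (mk (wires 1)) (mk (X 1 2 0)) (mk (X 0 1 0)) (mk (X 1 2 0)), id_seq,
            X_seq_X 0 1 2 le_rfl, add_zero (0 : ZMod 8), X_zero_two,
            interchange (mk (Z 2 1 0)) (mk (wires 1)) (mk (Z 2 1 0)) (mk (Z 1 0 0)), seq_id,
            Z_seq_Z 2 1 0 le_rfl, add_zero (0 : ZMod 8), Z_two_zero]
    _ = mk (X 1 2 0) ⨟ ((mk (wires 2) ⊠ mk cup) ⨟ ((mk (wires 1) ⊠ mk swap) ⊠ mk (wires 1)) ⨟
            (mk (wires 2) ⊠ mk cap)) ⨟ mk (Z 2 1 0) := by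
          rw [par_eq_seq_left (mk (X 1 2 0)), par_empty, par_eq_seq_right (mk (Z 2 1 0)), par_empty]
          simp only [seq_assoc]
    _ = mk (X 1 2 0) ⨟ mk (Z 2 1 0) := by rw [yank_twist_two, seq_id]

/-- **Copy disconnects**: a red split whose second output meets a green phase-free effect, with
JPV's `√2`, is "green effect, then green state": `√2 ⊗ (X^{(1,2)} ⨾ (𝕀 ⊗ Z^{(1,0)})) =
Z^{(1,0)} ⨾ Z^{(0,1)}` ((B1) flipped and colour-swapped, after bending the split).
[cite: JeandelPerdrixVilmart2018, Fig. 1 (B1)] -/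
theorem sqrt_two_par_X_split_par_effect :
    mk (dumbbell 0 0) ⊠ (mk (X 1 2 0) ⨟ (mk (wires 1) ⊠ mk (Z 1 0 0))) = mk (Z 1 0 0) ⨟ mk (Z 0 1 0) := by
  have hbend : mk (X 1 2 0) = (mk cup ⊠ mk (wires 1)) ⨟ (mk (wires 1) ⊠ mk (X 2 1 0)) := by
    simpa using (Rule.colorSwap Rule.spider_bend).eq.symm
  calc mk (dumbbell 0 0) ⊠ (mk (X 1 2 0) ⨟ (mk (wires 1) ⊠ mk (Z 1 0 0)))
        = mk (dumbbell 0 0) ⊠ ((mk cup ⊠ mk (wires 1)) ⨟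
            (mk (wires 1) ⊠ (mk (X 2 1 0) ⨟ mk (Z 1 0 0)))) := by
          rw [hbend, seq_assoc, ← wires_par_seq]
    _ = (mk cup ⊠ mk (wires 1)) ⨟
          (mk (wires 1) ⊠ (mk (dumbbell 0 0) ⊠ (mk (X 2 1 0) ⨟ mk (Z 1 0 0)))) := by
          rw [scalar_par_seq_right, empty_par, cast_id, par_assoc', cast_id, scalar_par_wires]
          exact congrArg _ ((par_assoc (mk (wires 1)) (mk (dumbbell 0 0))
            (mk (X 2 1 0) ⨟ mk (Z 1 0 0))).trans (cast_id _ _ _))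
    _ = (mk cup ⊠ mk (wires 1)) ⨟ ((mk (wires 1) ⊠ mk (Z 1 0 0)) ⊠ mk (Z 1 0 0)) := by
          rw [rule_B1_effect]
          exact congrArg _ ((par_assoc (mk (wires 1)) (mk (Z 1 0 0)) (mk (Z 1 0 0))).trans
            (cast_id _ _ _)).symm
    _ = mk (Z 0 1 0) ⊠ mk (Z 1 0 0) := by rw [interchange, cup_seq_par_effect, id_seq]
    _ = mk (Z 1 0 0) ⨟ mk (Z 0 1 0) := by
          rw [par_eq_seq_right, empty_par, cast_id, par_empty]

/-- **A green phase-free state is deleted by a red merge**, with JPV's `√2`: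
`√2 ⊗ ((Z^{(0,1)} ⊗ 𝕀) ⨾ X^{(2,1)}) = Z^{(1,0)} ⨾ Z^{(0,1)}` (the flip of the previous lemma).
[cite: JeandelPerdrixVilmart2018, Fig. 1 (B1)] -/
theorem sqrt_two_par_state_par_X_merge :
    mk (dumbbell 0 0) ⊠ ((mk (Z 0 1 0) ⊠ mk (wires 1)) ⨟ mk (X 2 1 0)) = mk (Z 1 0 0) ⨟ mk (Z 0 1 0) := by
  have h := congrArg transpose sqrt_two_par_X_split_par_effect
  simp only [transpose_par, transpose_seq, transpose_mk, mk_transpose_dumbbell_zero, transpose_X,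
    transpose_Z, transpose_wires] at h
  -- `h` has the state on the SECOND input; exchange the inputs of the red merge
  rw [← swap_seq_X 1 0, ← seq_assoc] at h
  have hs : (mk (wires 1) ⊠ mk (Z 0 1 0)) ⨟ mk swap = mk (Z 0 1 0) ⊠ mk (wires 1) := by
    have hn := congrArg (· ⨟ mk swap) (swap_nat (mk (Z 0 1 0)))
    simp only [bswap1_zero, bswap1_one, id_seq, seq_assoc, swap_seq_swap, seq_id] at hn
    exact hn.symm
  rwa [hs] at h

/-- **The Hopf law** (JPV Lemma 3): with two scalars `√2`, a red split followed by a green merge of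
both wires disconnects: `√2 · √2 · (X^{(1,2)}(0) ⨾ Z^{(2,1)}(0)) = X^{(1,0)}(0) ⨾ Z^{(0,1)}(0)`.
Derivation (Backens–Perdrix–Wang): bialgebra on the doubled wire, then copy, then bending.
[cite: JeandelPerdrixVilmart2018, Appendix Lemma 3] -/
theorem hopf : mk (dumbbell 0 0) ⊠ (mk (dumbbell 0 0) ⊠ (mk (X 1 2 0) ⨟ mk (Z 2 1 0))) =
    mk (X 1 0 0) ⨟ mk (Z 0 1 0) := by
  -- bialgebra consumes the inner `√2`
  have step1 : mk (dumbbell 0 0) ⊠ (mk (X 1 2 0) ⨟ mk (Z 2 1 0)) =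
      (mk (wires 1) ⊠ mk (X 0 1 0)) ⨟ (mk (Z 2 1 0) ⨟ mk (X 1 2 0)) ⨟
        (mk (wires 1) ⊠ mk (Z 1 0 0)) := by
    rw [X_split_seq_Z_merge_eq, scalar_par_seq_left, scalar_par_seq_right, rule_B2_red, empty_par,
      cast_id, empty_par, cast_id]
  -- copy consumes the outer `√2`
  have step2 := sqrt_two_par_X_split_par_effect
  -- assemble
  rw [scalar_par_seq_right, empty_par, cast_id] at step2
  rw [step1, scalar_par_seq_right, empty_par, cast_id, seq_assoc, seq_assoc, step2, ← seq_assoc,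
    ← seq_assoc, seq_assoc (mk (wires 1) ⊠ mk (X 0 1 0)) (mk (Z 2 1 0)) (mk (Z 1 0 0)),
    Z_seq_Z 2 1 0 le_rfl, add_zero (0 : ZMod 8), Z_two_zero, par_xstate_seq_cap]

end ZXClass

end Literature.Computability.QuantumComplexity
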